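import Mathlib.RingTheory.Polynomial.Cyclotomic.Basic
import Mathlib.RingTheory.RootsOfUnity.Complex
import Mathlib.Data.List.GetD
import Literature.Computability.AlgebraicComplexity.ConstantFreeCircuits
import HarnessLib

/-!
# Lipton–Stockmeyer's example `f_n = x^{2^n} − 1`: complexity `≤ n + 1`, yet `2^n` linear factors
# (Bürgisser 2024 survey, §3.2)

P. Bürgisser, *Completeness classes in algebraic complexity theory* (arXiv:2406.06217, 2024),
§3.2 (held text `paper:arxiv-2406.06217`, p0013 L95–L99): "Lipton and Stockmeyer [LS78]
discovered that there exist polynomials `f` having factors with a complexity exponential in the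
complexity of `f`. An example is `f_n = x^{2^n} − 1 = ∏_{j<2^n} (x − ζ^j)`, where
`ζ = exp(2πi/2^n)`. By repeated squaring we get `L(f_n) ≤ n + 1`." (The sequel, "for almost all
`M ⊆ {0, …, 2^n − 1}`, `∏_{j∈M}(x − ζ^j)` has complexity exponential in `n`", a counting /
transcendence-degree argument, is NOT formalised here.)

THEOREM-ONLY file (no definitions, no named facts), in the tree's circuit model
(`ArithCircuit`, `complexity` = least size of a fan-in-two circuit, `ArithCircuit.lean`):

* `exists_circuit_X_pow_two_pow_sub_one`, `Bur24_sec3_2_complexity_X_pow_two_pow_sub_one_le` —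
  **`L(x^{2^n} − 1) ≤ n + 1`** over every commutative ring and in any set of variables: the
  circuit `g_1 = x·x, g_2 = g_1·g_1, …, g_n = g_{n-1}·g_{n-1} = x^{2^n}, g_{n+1} = 1·g_n + (−1)·1`
  (`exists_gates_repeated_squaring` builds the squaring gates with their values); the circuit is
  constant-free, so also `τ(x^{2^n} − 1) ≤ n + 1`
  (`Bur24_sec3_2_constantFreeComplexity_X_pow_two_pow_sub_one_le`), and likewise
  `τ((x+1)^{2^n}) ≤ n + 1` (`Bur24_sec4_2_constantFreeComplexity_X_add_one_pow_two_pow_le`) — the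
  survey's §4.2 example "`(X+1)^{2^n} ∈ VPnb⁰`" of a constant-free poly-size family of
  exponential degree (p0016 L5–L6; the class `VPnb⁰` is not introduced here);
* `Bur24_sec3_2_X_pow_sub_one_eq_prod_range` — `X^m − 1 = ∏_{j<m} (X − ζ^j)` in `R[X]` for a
  primitive `m`-th root of unity `ζ` in a domain `R` (Mathlib's `Polynomial.X_pow_sub_one_eq_prod`
  over `nthRootsFinset`, re-indexed by the powers of `ζ`), and
  `Bur24_sec3_2_X_pow_two_pow_sub_one_eq_prod` — the displayed identity
  `x^{2^n} − 1 = ∏_{j<2^n} (x − ζ^j)`, `ζ = exp(2πi/2^n)`, for the variable `x = X v` of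
  `MvPolynomial σ ℂ`.

## References

* [Burgisser2024Completeness] P. Bürgisser, arXiv:2406.06217 (2024), §3.2 (p0013 L95–L99), §4.2
  (p0016 L1–L6, Def. 4.4).
* [LiptonStockmeyer1978] R. J. Lipton, L. J. Stockmeyer, *Evaluation of polynomials with
  super-preconditioning*, J. Comput. Syst. Sci. 16 (2) (1978) 124–139,
  doi:10.1016/0022-0000(78)90041-7 (the survey's [list:78]; the original of the example).
-/

noncomputable section

open MvPolynomial

namespace Literature.Computability.AlgebraicComplexity

universe u v

section RepeatedSquaring

variable {k : Type u} [CommRing k] {σ : Type v}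

open ArithCircuit in
/-- **Repeated squaring as a gate list**: a first gate `g₀` with (stand-alone) value `p` followed by
`m` fan-in-two, constant-free product gates `g_j = g_{j-1} · g_{j-1}`; the value of gate `j ≤ m` is
`p^{2^j}`. [cite: Burgisser2024Completeness, §3.2 (p0013 L97–L98)] -/
theorem exists_gates_repeated_squaring (g₀ : Gate k σ) (m : ℕ) :
    ∃ gs : List (Gate k σ), gs.length = m ∧ (∀ g ∈ gs, g.fanIn ≤ 2 ∧ g.HasSignConstants) ∧
      ∀ j, j ≤ m → (gateValues (g₀ :: gs)).getD j 0 = (g₀.eval []) ^ 2 ^ j := by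
  induction m with
  | zero =>
    refine ⟨[], rfl, by simp, fun j hj => ?_⟩
    obtain rfl : j = 0 := Nat.le_zero.1 hj
    have h := gateValues_append_singleton (k := k) ([] : List (Gate k σ)) g₀
    simp only [List.nil_append] at h
    rw [h]
    simp [gateValues]
  | succ m ih =>
    obtain ⟨gs, hlen, hfan, hval⟩ := ih
    refine ⟨gs ++ [.prod [.gate m, .gate m]], by simp [hlen], ?_, ?_⟩
    · intro g hg
      rcases List.mem_append.1 hg with hg | hg
      · exact hfan g hg
      · rw [List.mem_singleton.1 hg]
        exact ⟨by simp [Gate.fanIn, Gate.args], fun u hu => by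
          simp only [List.mem_cons, List.mem_nil_iff, or_false] at hu
          rcases hu with rfl | rfl <;> trivial⟩
    · intro j hj
      have hlen' : (gateValues (g₀ :: gs)).length = m + 1 := by
        rw [gateValues_length, List.length_cons, hlen]
      rw [← List.cons_append, gateValues_append_singleton]
      rcases Nat.lt_or_ge j (m + 1) with hjm | hjm
      · rw [List.getD_append _ _ _ _ (by omega)]
        exact hval j (by omega)
      · obtain rfl : j = m + 1 := le_antisymm hj hjm
        rw [List.getD_append_right _ _ _ _ (by omega), hlen', Nat.sub_self, List.getD_cons_zero]
        simp only [Gate.eval, List.map_cons, List.map_nil, List.prod_cons, List.prod_nil, mul_one,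
          Operand.eval, hval m le_rfl]
        rw [← pow_add, ← two_mul, ← pow_succ']

open ArithCircuit in
/-- **Bürgisser 2024, §3.2 (Lipton–Stockmeyer's example): `x^{2^n} − 1` has a fan-in-two,
constant-free circuit of size `n + 1`** — `g_1 = x·x`, `g_j = g_{j-1}·g_{j-1}` (`j ≤ n`),
`g_{n+1} = 1·g_n + (−1)·1` — over every commutative ring, in any set of variables (`x = X v`).
[cite: Burgisser2024Completeness, §3.2 (p0013 L97–L98)] -/
theorem exists_circuit_X_pow_two_pow_sub_one (v : σ) (n : ℕ) :
    ∃ P : ArithCircuit k σ, P.IsFanInTwo ∧ P.HasSignConstants ∧ P.size = n + 1 ∧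
      P.Computes ((X v : MvPolynomial σ k) ^ 2 ^ n - 1) := by
  -- the last gate, reading an operand `u` of value `x^{2^n}`
  have key : ∀ (gs : List (Gate k σ)) (u : Operand k σ), gs.length = n →
      (∀ g ∈ gs, g.fanIn ≤ 2 ∧ g.HasSignConstants) → u.HasSignConstants →
      u.eval (gateValues gs) = (X v : MvPolynomial σ k) ^ 2 ^ n →
      ∃ P : ArithCircuit k σ, P.IsFanInTwo ∧ P.HasSignConstants ∧ P.size = n + 1 ∧
        P.Computes ((X v : MvPolynomial σ k) ^ 2 ^ n - 1) := by
    intro gs u hlen hgs hu2 hu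
    refine ⟨{ gates := gs ++ [.sum [((1 : k), u), ((-1 : k), .const 1)]], output := .gate n },
      ?_, ⟨?_, trivial⟩, by simp [ArithCircuit.size, hlen], ?_⟩
    · intro g hg
      rcases List.mem_append.1 hg with hg | hg
      · exact (hgs g hg).1
      · rw [List.mem_singleton.1 hg]; simp [Gate.fanIn, Gate.args]
    · intro g hg
      rcases List.mem_append.1 hg with hg | hg
      · exact (hgs g hg).2
      · rw [List.mem_singleton.1 hg]
        intro a ha
        simp only [List.mem_cons, List.mem_nil_iff, or_false] at ha
        rcases ha with rfl | rfl
        · exact ⟨Or.inr (Or.inl rfl), hu2⟩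
        · exact ⟨Or.inr (Or.inr (by simp)), Or.inr (Or.inl rfl)⟩
    · have hlen' := gateValues_length (k := k) gs
      change Operand.eval (gateValues (gs ++ [_])) (.gate n) = _
      simp only [Operand.eval]
      rw [gateValues_append_singleton, List.getD_append_right _ _ _ _ (by omega), hlen', hlen,
        Nat.sub_self, List.getD_cons_zero]
      simp only [Gate.eval, List.map_cons, List.map_nil, List.sum_cons, List.sum_nil, add_zero]
      rw [hu]
      simp only [Operand.eval, map_one, one_smul, neg_one_smul]
      ring
  cases n with
  | zero =>
    -- `x − 1`: one gate, reading the variable directly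
    exact key [] (.var v) rfl (by simp) trivial (by simp [Operand.eval])
  | succ n =>
    -- `g_1 = x·x`, then `n` squarings: gate `n` has value `(x²)^{2^n} = x^{2^{n+1}}`
    obtain ⟨gs, hlen, hfan, hval⟩ :=
      exists_gates_repeated_squaring (k := k) (.prod [.var v, .var v] : Gate k σ) n
    refine key (Gate.prod [.var v, .var v] :: gs) (.gate n) (by simp [hlen]) ?_ trivial ?_
    · intro g hg
      rcases List.mem_cons.1 hg with rfl | hg
      · exact ⟨by simp [Gate.fanIn, Gate.args], fun u hu => by
          simp only [List.mem_cons, List.mem_nil_iff, or_false] at hu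
          rcases hu with rfl | rfl <;> trivial⟩
      · exact hfan g hg
    · simp only [Operand.eval]
      rw [hval n le_rfl]
      simp only [Gate.eval, List.map_cons, List.map_nil, List.prod_cons, List.prod_nil, mul_one,
        Operand.eval]
      rw [← pow_two, ← pow_mul, ← pow_succ']

/-- **`L(x^{2^n} − 1) ≤ n + 1` by repeated squaring** (Bürgisser 2024, §3.2), for the tree's
fan-in-two circuit complexity `complexity`, over every commutative ring.
[cite: Burgisser2024Completeness, §3.2 (p0013 L97–L98)] -/
theorem Bur24_sec3_2_complexity_X_pow_two_pow_sub_one_le (v : σ) (n : ℕ) :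
    complexity ((X v : MvPolynomial σ k) ^ 2 ^ n - 1) ≤ n + 1 := by
  obtain ⟨P, h2, -, hs, hc⟩ := exists_circuit_X_pow_two_pow_sub_one (k := k) v n
  exact hs ▸ ArithCircuit.complexity_le_size h2 hc

/-- The same bound for the constant-free measure `τ`: `τ(x^{2^n} − 1) ≤ n + 1` (the circuit uses
only the constants `1, −1`). [cite: Burgisser2024Completeness, §3.2 (p0013 L97–L98)] -/
theorem Bur24_sec3_2_constantFreeComplexity_X_pow_two_pow_sub_one_le (v : σ) (n : ℕ) :
    constantFreeComplexity ((X v : MvPolynomial σ k) ^ 2 ^ n - 1) ≤ n + 1 := by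
  obtain ⟨P, h2, hsg, hs, hc⟩ := exists_circuit_X_pow_two_pow_sub_one (k := k) v n
  exact hs ▸ ArithCircuit.constantFreeComplexity_le_size h2 hsg hc

open ArithCircuit in
/-- **Bürgisser 2024, §4.2 (p0016 L5–L6): "the sequence `(X+1)^{2^n} = Σ_i binom(2^n, i) X^i` is in
`VPnb⁰`"** — rendered by the constant-free size bound it rests on: `(x+1)^{2^n}` has a fan-in-two
constant-free circuit of size `n + 1` (`g_0 = 1·x + 1·1`, then `n` squarings), so
`τ((x+1)^{2^n}) ≤ n + 1` although the degree `2^n` and the bit size of the coefficients grow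
exponentially (the class `VPnb⁰` itself, Def. 4.4, is not introduced here).
[cite: Burgisser2024Completeness, §4.2 (p0016 L1–L6) and Def. 4.4] -/
theorem Bur24_sec4_2_constantFreeComplexity_X_add_one_pow_two_pow_le (v : σ) (n : ℕ) :
    constantFreeComplexity (((X v : MvPolynomial σ k) + 1) ^ 2 ^ n) ≤ n + 1 := by
  obtain ⟨gs, hlen, hfan, hval⟩ := exists_gates_repeated_squaring (k := k)
    (.sum [((1 : k), .var v), ((1 : k), .const 1)] : Gate k σ) n
  let P : ArithCircuit k σ :=
    { gates := Gate.sum [((1 : k), .var v), ((1 : k), .const 1)] :: gs, output := .gate n }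
  have h2 : P.IsFanInTwo := by
    intro g hg
    rcases List.mem_cons.1 hg with rfl | hg
    · simp [Gate.fanIn, Gate.args]
    · exact (hfan g hg).1
  have hsg : P.HasSignConstants := by
    refine ⟨fun g hg => ?_, trivial⟩
    rcases List.mem_cons.1 hg with rfl | hg
    · intro a ha
      simp only [List.mem_cons, List.mem_nil_iff, or_false] at ha
      rcases ha with rfl | rfl
      · exact ⟨Or.inr (Or.inl rfl), trivial⟩
      · exact ⟨Or.inr (Or.inl rfl), Or.inr (Or.inl rfl)⟩
    · exact (hfan g hg).2
  have hc : P.Computes (((X v : MvPolynomial σ k) + 1) ^ 2 ^ n) := by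
    change Operand.eval (gateValues (_ :: gs)) (.gate n) = _
    simp only [Operand.eval]
    rw [hval n le_rfl]
    simp [Gate.eval, Operand.eval]
  have hs : P.size = n + 1 := by simp [P, ArithCircuit.size, hlen]
  exact hs ▸ constantFreeComplexity_le_size h2 hsg hc

end RepeatedSquaring

section Factors

/-- `X^m − 1 = ∏_{j<m} (X − ζ^j)` in `R[X]` for a primitive `m`-th root of unity `ζ` in a domain
`R` (Mathlib's `Polynomial.X_pow_sub_one_eq_prod`, re-indexed by the powers `ζ^j`, `j < m`, which
enumerate the `m`-th roots of unity without repetition). [cite: Burgisser2024Completeness, §3.2 (p0013 L97)] -/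
theorem Bur24_sec3_2_X_pow_sub_one_eq_prod_range {R : Type u} [CommRing R] [IsDomain R] {ζ : R}
    {m : ℕ} (hm : 0 < m) (h : IsPrimitiveRoot ζ m) :
    (Polynomial.X ^ m - 1 : Polynomial R) =
      ∏ j ∈ Finset.range m, (Polynomial.X - Polynomial.C (ζ ^ j)) := by
  classical
  haveI : NeZero m := ⟨hm.ne'⟩
  rw [Polynomial.X_pow_sub_one_eq_prod hm h]
  have hset : Polynomial.nthRootsFinset m (1 : R) = (Finset.range m).image fun j => ζ ^ j := by
    ext μ
    rw [Polynomial.mem_nthRootsFinset hm, Finset.mem_image]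
    constructor
    · intro hμ
      obtain ⟨i, hi, rfl⟩ := h.eq_pow_of_pow_eq_one hμ
      exact ⟨i, Finset.mem_range.2 hi, rfl⟩
    · rintro ⟨i, -, rfl⟩
      rw [← pow_mul, mul_comm, pow_mul, h.pow_eq_one, one_pow]
  rw [hset, Finset.prod_image]
  intro i hi j hj hij
  exact h.pow_inj (Finset.mem_range.1 hi) (Finset.mem_range.1 hj) hij

/-- **Bürgisser 2024, §3.2, the displayed factorisation `x^{2^n} − 1 = ∏_{j<2^n} (x − ζ^j)`,
`ζ = exp(2πi/2^n)`**, for the variable `x = X v` of `MvPolynomial σ ℂ`: `2^n` linear factors of a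
polynomial of complexity `≤ n + 1` (`Bur24_sec3_2_complexity_X_pow_two_pow_sub_one_le`).
[cite: Burgisser2024Completeness, §3.2 (p0013 L95–L98)] -/
theorem Bur24_sec3_2_X_pow_two_pow_sub_one_eq_prod {σ : Type v} (v : σ) (n : ℕ) :
    ((X v : MvPolynomial σ ℂ) ^ 2 ^ n - 1) =
      ∏ j ∈ Finset.range (2 ^ n),
        (X v - C (Complex.exp (2 * Real.pi * Complex.I / (2 ^ n : ℕ)) ^ j)) := by
  have hm : 0 < 2 ^ n := Nat.two_pow_pos n
  have hζ := Complex.isPrimitiveRoot_exp (2 ^ n) hm.ne'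
  have h := congrArg (Polynomial.aeval (X v : MvPolynomial σ ℂ))
    (Bur24_sec3_2_X_pow_sub_one_eq_prod_range hm hζ)
  simpa [map_prod, Polynomial.aeval_X, Polynomial.aeval_C] using h

end Factors

end Literature.Computability.AlgebraicComplexity

end
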